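import Summits.ResolutionOfSingularities.ResolutionOfSingularities.Theorems.FrobeniusClosingPatchingRelPerfectSigmaCalculusCharts
import HarnessLib

/-!
# Crux `PatchingRelPerfect` (stmt-ResolutionOfSingularities-16161), chain w52 — rung tool r2Σ-a,
# part 3: the chart lemmas packaged with the natural hypothesis `g ∈ (X_j : j ∈ A₀)^ν`

[OURS · L1 W5.2 · rung tool] Parts 1–2 (`…SigmaCalculusPrelim.lean`, `…SigmaCalculusCharts.lean`)
prove the Σ-calculus chart lemma of CORE-MECHANISM-NOTE §3a for coordinate centres under a
FACTORISATION hypothesis on the chart transform of `g` (`subst g = X_{j₀}^{μ+2} · g′`).  Here the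
hypothesis is the one of the NOTE — **`g` has multiplicity `≥ ν = μ + 2` along the centre**,
`g ∈ (X_j : j ∈ A₀)^{μ+2}` — and the factorisations are produced internally
(`exists_coordBlowupSubst_eq_pow_mul`, `rename_some_mem_pow` of part 1):

* `exists_baseChartEquiv_of_mem_pow` — on the chart of a centre coordinate `w = X_{base j₀}`,
  `j₀ ∈ A₀`, the blown-up suspension is the suspension of `w^μ · G′` for SOME chart transform `G′`;
* `isRegularRing_uChart_of_mem_pow`, `isRegularRing_sChart_of_mem_pow` — the `u`- and `s`-charts
  are regular (`S` a regular domain, `τ` finite).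

No definitions; nothing here is a statement of the manuscript under review.

## References

* U. Görtz, T. Wedhorn, *Algebraic Geometry I* (2nd ed., 2020), Prop. 13.96 (2), p. 416. [GortzWedhorn2020]
* Y. Hu, arXiv:2507.21400 (2025), §5 Prop. 5.3. [Hu2025]
-/

-- `Summit.<Summit>.<Sub>.Theorems` with `Sub = Summit` (single-conjunct summit, D-0017)
set_option linter.dupNamespace false

noncomputable section

open MvPolynomial Literature.AlgebraicGeometry.Resolution

namespace Summit.ResolutionOfSingularities.ResolutionOfSingularities.Theorems

namespace SigmaCalculus

universe u v

variable {S : Type u} [CommRing S] [IsDomain S] {τ : Type v} (A₀ : Set τ)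

local notation3 "base" => (fun t : τ => (some (some t) : Option (Option τ)))
local notation3 "centre" =>
  insert none (insert (some none) ((fun t : τ => (some (some t) : Option (Option τ))) '' A₀))
local notation3 "R" => MvPolynomial (Option (Option τ)) S
local notation3 "P" => Ideal.span (X '' (centre) : Set (MvPolynomial (Option (Option τ)) S))

/-- **r2Σ-a with the multiplicity hypothesis, chart of a centre coordinate.** For a domain `S`,
a coordinate centre `C = V(X_j : j ∈ A₀)`, `j₀ ∈ A₀`, and `g ∈ (X_j : j ∈ A₀)^{μ+2}`
(multiplicity `≥ μ + 2` along `C`), the chart ring over `w̄ = X̄_{base j₀}` of the blow-up of the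
suspension `Spec S[X_σ]/(G - X_u X_s)` along `C × {u = s = 0}` is the suspension
`S[X_σ] ⧸ (w^μ · rename base g′ - X_u X_s)` of SOME `g′` with `subst g = X_{j₀}^{μ+2} g′` (the
chart transform). [cite: GortzWedhorn2020, Prop. 13.96 (2) and p. 416] [cite: Hu2025, §5 Prop. 5.3] -/
theorem exists_baseChartEquiv_of_mem_pow {j₀ : τ} (hj₀ : j₀ ∈ A₀) {g : MvPolynomial τ S}
    {μ : ℕ} (hg : g ∈ Ideal.span (X '' A₀) ^ (μ + 2)) :
    ∃ g' : MvPolynomial τ S, coordBlowupSubst S A₀ j₀ g = X j₀ ^ (μ + 2) * g' ∧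
      Nonempty (blowupAlgebra ((P).map (Ideal.Quotient.mk
          (Ideal.span {(rename base g - X (some none) * X none : R)})))
        (Ideal.Quotient.mk (Ideal.span {(rename base g - X (some none) * X none : R)})
          (X (some (some j₀)))) ≃+*
      (R) ⧸ Ideal.span {X (some (some j₀)) ^ μ * rename base g' - X (some none) * X none}) := by
  obtain ⟨g', hg'⟩ := exists_coordBlowupSubst_eq_pow_mul S A₀ hj₀ hg
  exact ⟨g', hg', nonempty_baseChartEquiv A₀ hg'⟩

/-- **The `u`-chart is regular under the multiplicity hypothesis** (`S` a regular domain, `τ`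
finite, `g ∈ (X_j : j ∈ A₀)^{μ+2}`). [cite: GortzWedhorn2020, Prop. 13.96 (2) and p. 416] -/
theorem isRegularRing_uChart_of_mem_pow [IsRegularRing S] [Finite τ] {g : MvPolynomial τ S}
    {μ : ℕ} (hg : g ∈ Ideal.span (X '' A₀) ^ (μ + 2)) :
    IsRegularRing (blowupAlgebra ((P).map (Ideal.Quotient.mk
        (Ideal.span {(rename base g - X (some none) * X none : R)})))
      (Ideal.Quotient.mk (Ideal.span {(rename base g - X (some none) * X none : R)})
        (X (some none)))) := by
  obtain ⟨Gt, hGt⟩ := exists_coordBlowupSubst_eq_pow_mul S (insert none (some '' A₀))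
    (Set.mem_insert _ _) (rename_some_mem_pow S A₀ hg)
  exact isRegularRing_uChart A₀ hGt

/-- **The `s`-chart is regular under the multiplicity hypothesis** (`S` a regular domain, `τ`
finite, `g ∈ (X_j : j ∈ A₀)^{μ+2}`). [cite: GortzWedhorn2020, Prop. 13.96 (2) and p. 416] -/
theorem isRegularRing_sChart_of_mem_pow [IsRegularRing S] [Finite τ] {g : MvPolynomial τ S}
    {μ : ℕ} (hg : g ∈ Ideal.span (X '' A₀) ^ (μ + 2)) :
    IsRegularRing (blowupAlgebra ((P).map (Ideal.Quotient.mk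
        (Ideal.span {(rename base g - X (some none) * X none : R)})))
      (Ideal.Quotient.mk (Ideal.span {(rename base g - X (some none) * X none : R)})
        (X none))) := by
  obtain ⟨Gt, hGt⟩ := exists_coordBlowupSubst_eq_pow_mul S (insert none (some '' A₀))
    (Set.mem_insert _ _) (rename_some_mem_pow S A₀ hg)
  exact isRegularRing_sChart A₀ hGt

end SigmaCalculus

end Summit.ResolutionOfSingularities.ResolutionOfSingularities.Theorems

end
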